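import Literature.NumberTheory.Automorphic.ArchRankOneCasimirUniform          -- ★ p850750∕p850812 (this seat): `E′`-reading through CLMs, centre translation, ★ (CURRY-∞) consumed
import HarnessLib

/-!
# ALL ORDERS at the central wall, UNIFORMLY: the one-sided LIMITS of every jet of a curried family converge uniformly, and the centre-`z` family has continuous,
# uniformly attained one-sided limits on `S¹` (Varadarajan 1989 §6.4 Thms 22–24 read in `E′ = P →ᵇ E`; Bouaziz 1994 (I₂)–(I₃) uniformly in the other variables)

Topic `NumberTheory/Automorphic`; namespace `Literature.NumberTheory.Automorphic.RankOneCasimir`.  THEOREMS ONLY (no `def`, no instance, no notation, no axiom, no named fact,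
no `sorry`).  Cell `pub/hodgecm-mathlib`, line LH3 (closer stub `stub_N9`, crux H413 = `stmt-HodgeConjecture-24833`), brick **(ELL-∞-JUMP-UNIF)** (LH3-plan (g3) «= (ELL-∞-JUMP-UNIF)»,
2026-09-02T09:30:01Z: «the `z`-uniform ∕ circle-uniform form of the ★ all-orders one-sided jump, hypothesis-free for `f ∈ C_c^∞`, `E` Banach, sequel of ★ p850812»); consumer =
LH3-p01 (g4)'s (α3)∕(α4) via ★ p850802 (CURRY-∞, F0P3a-p02 (g20)); author LH3-p04 (g4).

THE MATHEMATICS.  ★ `ArchRankOneCasimirLadder` gives, for every Banach `E′` and `g ∈ C_c^∞(M₂(ℂ), E′)`, one-sided limits `Lp′`, `Lm′ ∈ E′` of every jet `(F′ g)⁽ⁿ⁾` at `ψ = 0`; ★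
`ArchRankOneCasimirUniform` gives `(F (ℓ ∘ g))⁽ⁿ⁾ ψ = ℓ ((F′ g)⁽ⁿ⁾ ψ)` on the punctured interval for every CLM `ℓ : E′ →L[ℝ] E`.  Hence (§1–§2) the jets of the whole family
`{ℓ ∘ g}` converge to `ℓ Lp′`, `ℓ Lm′` UNIFORMLY: `‖(F (ℓ ∘ g))⁽ⁿ⁾ ψ − ℓ Lp′‖ ≤ ‖ℓ‖·ε` for `0 < ψ < δ(ε)` with ONE `δ(ε)` for all `ℓ` — the `E′`-reading of Harish-Chandra's one-sided
limits; with `E′ = P →ᵇ E`, `ℓ = evalCLM ℝ p` this is uniform convergence in the compact parameter `p` (what the multi-place transport integrates over the other leaves).  §3: for the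
centre family `F_z f = F_1 (f ∘ (z • ·))` (★ `orbitalIntegral_centre_eq`) and the curried `g X = (z ↦ f (z • X)) ∈ C_c^∞(M₂(ℂ), S¹ →ᵇ E)` (★ `exists_contDiff_curry_circle_smul`) the
one-sided limits of `(F_z f)⁽ⁿ⁾` are the VALUES `Lp′ z`, `Lm′ z` of two bounded continuous functions on `S¹`, attained UNIFORMLY in `z`, hypothesis-free for `f ∈ C_c^∞(M₂(ℂ), E)`;
§4: for `E = ℂ` the jump `z ↦ Lp′ z − Lm′ z` of every jet is a continuous function of the centre and `HasOneSidedJump ((F_z f)⁽ⁿ⁾) (Lp′ z − Lm′ z)` for all `z` (its explicit value at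
each `z` is ★ `exists_hasOneSidedJump_iteratedDeriv_orbitalIntegral`: `0` at odd orders, `(−1)ᵏ C₁·`cone`((1+Ω)ᵏ f)` at order `2k`).
HONEST LABEL: HC_CM is proved only modulo the 7 printed citations (2 remaining: hLiu418 = stmt-HodgeConjecture-24832, h413 = stmt-HodgeConjecture-24833) until rung 0 closes;
bookkeeping over ★ p850639∕p850750∕p850812∕p850802, count-neutral, pays nothing by itself.

WHAT IS PROVED.
* §1 `eventually_forall_norm_clm_sub_le_of_tendsto` (generic: a limit in `E′` is attained uniformly through all CLMs, scaled by `‖ℓ‖`).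
* §2 **`exists_tendsto_iteratedDeriv_orbitalIntegral_comp_clm_uniform`** (`∃ Lp Lm : E′`, per-`ℓ` limits `ℓ Lp`, `ℓ Lm` AND uniform `‖·− ℓ Lp‖ ≤ ‖ℓ‖·ε` on one punctured side-ball).
* §3 **`exists_tendsto_iteratedDeriv_orbitalIntegral_uniform_circle_of_contDiff`** (`∃ Lp Lm : Circle →ᵇ E`: pointwise one-sided limits `Lp z`, `Lm z` + uniform attainment in `z`).
* §4 (`E = ℂ`) **`exists_hasOneSidedJump_iteratedDeriv_orbitalIntegral_circle_of_contDiff`** (`∃ J : Circle →ᵇ ℂ, ∀ z, HasOneSidedJump (fun ψ => iteratedDeriv n (F z f) ψ) (J z)`).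

## References
* [Varadarajan1989] V. S. Varadarajan, *An Introduction to Harmonic Analysis on Semisimple Lie Groups*, Cambridge Stud. Adv. Math. 16 (1989), §6.4 Thms 22–24.
* [Bouaziz1994IntegralesOrbitales] A. Bouaziz, *Intégrales orbitales sur les groupes de Lie réductifs*, Ann. Sci. ÉNS 27 (1994), §3.1–3.2 (I₂), (I₃) pp. 579–580.
* [Shelstad1979] D. Shelstad, *Characters and inner forms of a quasi-split group over ℝ*, Compositio Math. 39 (1979), Lemma 4.3 p. 25.
-/

set_option autoImplicit false

noncomputable section

namespace Literature.NumberTheory.Automorphic.RankOneCasimir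

open _root_.Complex _root_.Matrix _root_.MeasureTheory _root_.Set _root_.Filter _root_.Topology _root_.NumberField _root_.NumberField.InfinitePlace
open _root_.Literature.NumberTheory.Automorphic _root_.Literature.NumberTheory.Automorphic.UnitaryGroup
open _root_.Literature.NumberTheory.Automorphic.Shelstad1979.StableOrbitalIntegrals
open scoped Matrix.Norms.Operator MatrixGroups ComplexConjugate ContDiff Real BoundedContinuousFunction

variable (L : Type) [Field L] (a : Fin 2 → L) (w : {w : InfinitePlace L // IsComplex w})
variable {E : Type*} [NormedAddCommGroup E] [NormedSpace ℝ E] [CompleteSpace E]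
variable {E' : Type*} [NormedAddCommGroup E'] [NormedSpace ℝ E'] [CompleteSpace E']

/-! ## §1 A limit in `E′` is attained uniformly through every continuous linear map -/

omit [CompleteSpace E] [CompleteSpace E'] in
/-- If `u → A` in `E′` along `l`, then for every `ε > 0`, eventually along `l`, `‖ℓ (u ψ) − ℓ A‖ ≤ ‖ℓ‖·ε` for ALL `ℓ : E′ →L[ℝ] E` at once. [cite: Varadarajan1989, §6.4 Thm 22] -/
theorem eventually_forall_norm_clm_sub_le_of_tendsto {u : ℝ → E'} {A : E'} {l : Filter ℝ} (hu : Tendsto u l (𝓝 A)) {ε : ℝ} (hε : 0 < ε) :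
    ∀ᶠ ψ in l, ∀ ℓ : E' →L[ℝ] E, ‖ℓ (u ψ) - ℓ A‖ ≤ ‖ℓ‖ * ε := by
  filter_upwards [hu (Metric.closedBall_mem_nhds A hε)] with ψ hψ ℓ
  rw [← map_sub]
  exact (ℓ.le_opNorm _).trans (mul_le_mul_of_nonneg_left (by simpa [dist_eq_norm] using Metric.mem_closedBall.1 hψ) (norm_nonneg _))

/-! ## §2 The one-sided limits of every jet of a curried family are attained uniformly -/

/-- **UNIFORM ONE-SIDED LIMITS OVER A CURRIED FAMILY**: for `g ∈ C_c^∞(M₂(ℂ), E′)` and every `n` there are `Lp Lm : E′` such that for every CLM `ℓ : E′ →L[ℝ] E` the jet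
`(F (ℓ ∘ g))⁽ⁿ⁾` tends to `ℓ Lp` along `𝓝[>] 0` and to `ℓ Lm` along `𝓝[<] 0`, and for every `ε > 0` ONE punctured side-neighbourhood of `0` gives `‖(F (ℓ ∘ g))⁽ⁿ⁾ ψ − ℓ Lp‖ ≤ ‖ℓ‖·ε`
(resp. `Lm`) for ALL `ℓ` — uniform convergence in a compact parameter once the family is curried (`E′ = P →ᵇ E`, `ℓ = evalCLM ℝ p`).
[cite: Varadarajan1989, §6.4 Thms 22–24] [cite: Bouaziz1994IntegralesOrbitales, §3.2 (I₃) p. 580] -/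
theorem exists_tendsto_iteratedDeriv_orbitalIntegral_comp_clm_uniform
    (ha : ∀ i, a i ≠ 0) (hreal : ∀ i, (w.1.embedding (a i)).im = 0) (hsgn : (w.1.embedding (a 0)).re * (w.1.embedding (a 1)).re < 0)
    {p q : ℝ} (hpq : p * q = 1) (hqe : (q : ℂ) ^ 2 * w.1.embedding (a 1) = -w.1.embedding (a 0))
    [MeasurableSpace (unitaryGroupOfForm (starRingEnd ℂ) ((Matrix.diagonal a).map w.1.embedding))]
    [BorelSpace (unitaryGroupOfForm (starRingEnd ℂ) ((Matrix.diagonal a).map w.1.embedding))]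
    (μ : Measure (unitaryGroupOfForm (starRingEnd ℂ) ((Matrix.diagonal a).map w.1.embedding))) [μ.IsHaarMeasure] [μ.IsMulRightInvariant]
    (Ω' : (Matrix (Fin 2) (Fin 2) ℂ → E') → Matrix (Fin 2) (Fin 2) ℂ → E')
    (hΩ' : ∀ (g : Matrix (Fin 2) (Fin 2) ℂ → E') (Y : Matrix (Fin 2) (Fin 2) ℂ), Ω' g Y =
      -(fderiv ℝ (fderiv ℝ g) Y (Y * !![I, 0; 0, -I]) (Y * !![I, 0; 0, -I]) + fderiv ℝ g Y (Y * !![I, 0; 0, -I] * !![I, 0; 0, -I])) +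
        (fderiv ℝ (fderiv ℝ g) Y (Y * !![(0 : ℂ), (p : ℂ); (q : ℂ), 0]) (Y * !![(0 : ℂ), (p : ℂ); (q : ℂ), 0]) +
          fderiv ℝ g Y (Y * !![(0 : ℂ), (p : ℂ); (q : ℂ), 0] * !![(0 : ℂ), (p : ℂ); (q : ℂ), 0])) +
        (fderiv ℝ (fderiv ℝ g) Y (Y * !![(0 : ℂ), -((p : ℂ) * I); (q : ℂ) * I, 0]) (Y * !![(0 : ℂ), -((p : ℂ) * I); (q : ℂ) * I, 0]) +
          fderiv ℝ g Y (Y * !![(0 : ℂ), -((p : ℂ) * I); (q : ℂ) * I, 0] * !![(0 : ℂ), -((p : ℂ) * I); (q : ℂ) * I, 0])))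
    (z : Circle) (F : (Matrix (Fin 2) (Fin 2) ℂ → E) → ℝ → E)
    (hF : ∀ (f : Matrix (Fin 2) (Fin 2) ℂ → E) (ψ : ℝ), F f ψ = (2 * Real.sin ψ) •
      ∫ h : unitaryGroupOfForm (starRingEnd ℂ) ((Matrix.diagonal a).map w.1.embedding),
        f (((h * ⟨circleDiagonal 2 ![z * Circle.exp ψ, z * Circle.exp (-ψ)], circleDiagonal_mem_archLocal_diagonal L 2 a w _⟩ * h⁻¹ :
          unitaryGroupOfForm (starRingEnd ℂ) ((Matrix.diagonal a).map w.1.embedding)) : GL (Fin 2) ℂ) : Matrix (Fin 2) (Fin 2) ℂ) ∂μ)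
    (F' : (Matrix (Fin 2) (Fin 2) ℂ → E') → ℝ → E')
    (hF' : ∀ (g : Matrix (Fin 2) (Fin 2) ℂ → E') (ψ : ℝ), F' g ψ = (2 * Real.sin ψ) •
      ∫ h : unitaryGroupOfForm (starRingEnd ℂ) ((Matrix.diagonal a).map w.1.embedding),
        g (((h * ⟨circleDiagonal 2 ![z * Circle.exp ψ, z * Circle.exp (-ψ)], circleDiagonal_mem_archLocal_diagonal L 2 a w _⟩ * h⁻¹ :
          unitaryGroupOfForm (starRingEnd ℂ) ((Matrix.diagonal a).map w.1.embedding)) : GL (Fin 2) ℂ) : Matrix (Fin 2) (Fin 2) ℂ) ∂μ)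
    {g : Matrix (Fin 2) (Fin 2) ℂ → E'} (hg : ContDiff ℝ ∞ g) (hgc : HasCompactSupport g) (n : ℕ) :
    ∃ Lp Lm : E',
      (∀ ℓ : E' →L[ℝ] E, Tendsto (fun ψ => iteratedDeriv n (F (fun X => ℓ (g X))) ψ) (𝓝[>] 0) (𝓝 (ℓ Lp)) ∧
        Tendsto (fun ψ => iteratedDeriv n (F (fun X => ℓ (g X))) ψ) (𝓝[<] 0) (𝓝 (ℓ Lm))) ∧
      ∀ ε : ℝ, 0 < ε →
        (∀ᶠ ψ in 𝓝[>] (0 : ℝ), ∀ ℓ : E' →L[ℝ] E, ‖iteratedDeriv n (F (fun X => ℓ (g X))) ψ - ℓ Lp‖ ≤ ‖ℓ‖ * ε) ∧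
        (∀ᶠ ψ in 𝓝[<] (0 : ℝ), ∀ ℓ : E' →L[ℝ] E, ‖iteratedDeriv n (F (fun X => ℓ (g X))) ψ - ℓ Lm‖ ≤ ‖ℓ‖ * ε) := by
  obtain ⟨Lp, Lm, hLp, hLm⟩ := exists_tendsto_iteratedDeriv_orbitalIntegral_nhdsGT_nhdsLT L a w ha hreal hsgn hpq hqe μ Ω' hΩ' z F' hF' hg hgc n
  have hmem : Ioo (-1 : ℝ) 1 ∩ {(0 : ℝ)}ᶜ ∈ 𝓝[≠] (0 : ℝ) :=
    inter_mem (mem_nhdsWithin_of_mem_nhds (Ioo_mem_nhds (by norm_num) (by norm_num))) self_mem_nhdsWithin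
  have hcomm : ∀ ψ ∈ Ioo (-1 : ℝ) 1 ∩ {(0 : ℝ)}ᶜ, ∀ ℓ : E' →L[ℝ] E, iteratedDeriv n (F (fun X => ℓ (g X))) ψ = ℓ (iteratedDeriv n (F' g) ψ) := fun ψ hψ ℓ =>
    iteratedDeriv_orbitalIntegral_comp_clm L a w ha hreal hsgn hpq hqe μ Ω' hΩ' z F hF F' hF' ℓ hg hgc n hψ.1 hψ.2
  refine ⟨Lp, Lm, fun ℓ => ⟨?_, ?_⟩, fun ε hε => ⟨?_, ?_⟩⟩
  · exact tendsto_iteratedDeriv_orbitalIntegral_comp_clm L a w ha hreal hsgn hpq hqe μ Ω' hΩ' z F hF F' hF' ℓ hg hgc (nhdsGT_le_nhdsNE 0) n hLp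
  · exact tendsto_iteratedDeriv_orbitalIntegral_comp_clm L a w ha hreal hsgn hpq hqe μ Ω' hΩ' z F hF F' hF' ℓ hg hgc (nhdsLT_le_nhdsNE 0) n hLm
  · filter_upwards [eventually_forall_norm_clm_sub_le_of_tendsto (E := E) hLp hε, nhdsGT_le_nhdsNE 0 hmem] with ψ hψ hψU ℓ
    rw [hcomm ψ hψU ℓ]
    exact hψ ℓ
  · filter_upwards [eventually_forall_norm_clm_sub_le_of_tendsto (E := E) hLm hε, nhdsLT_le_nhdsNE 0 hmem] with ψ hψ hψU ℓ
    rw [hcomm ψ hψU ℓ]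
    exact hψ ℓ

/-! ## §3 The centre family on `S¹`: continuous one-sided limits, attained uniformly in `z` -/

/-- **CIRCLE-UNIFORM ONE-SIDED LIMITS, HYPOTHESIS-FREE**: for `f ∈ C_c^∞(M₂(ℂ), E)` and every `n` there are two bounded continuous functions `Lp Lm : S¹ →ᵇ E` such that for every
centre `z`, `(F_z f)⁽ⁿ⁾ → Lp z` along `𝓝[>] 0` and `→ Lm z` along `𝓝[<] 0`, and for every `ε > 0` ONE punctured side-neighbourhood of `0` gives `‖(F_z f)⁽ⁿ⁾ ψ − Lp z‖ ≤ ε` (resp. `Lm`)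
for ALL `z ∈ S¹` (★ `orbitalIntegral_centre_eq` + §2 at `E′ = S¹ →ᵇ E`, `ℓ = evalCLM ℝ z`, + ★ (CURRY-∞) `exists_contDiff_curry_circle_smul`).
[cite: Varadarajan1989, §6.4 Thms 22–24] [cite: Bouaziz1994IntegralesOrbitales, §3.1–3.2 (I₂)–(I₃) pp. 579–580] -/
theorem exists_tendsto_iteratedDeriv_orbitalIntegral_uniform_circle_of_contDiff
    (ha : ∀ i, a i ≠ 0) (hreal : ∀ i, (w.1.embedding (a i)).im = 0) (hsgn : (w.1.embedding (a 0)).re * (w.1.embedding (a 1)).re < 0)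
    {p q : ℝ} (hpq : p * q = 1) (hqe : (q : ℂ) ^ 2 * w.1.embedding (a 1) = -w.1.embedding (a 0))
    [MeasurableSpace (unitaryGroupOfForm (starRingEnd ℂ) ((Matrix.diagonal a).map w.1.embedding))]
    [BorelSpace (unitaryGroupOfForm (starRingEnd ℂ) ((Matrix.diagonal a).map w.1.embedding))]
    (μ : Measure (unitaryGroupOfForm (starRingEnd ℂ) ((Matrix.diagonal a).map w.1.embedding))) [μ.IsHaarMeasure] [μ.IsMulRightInvariant]
    (F : Circle → (Matrix (Fin 2) (Fin 2) ℂ → E) → ℝ → E)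
    (hF : ∀ (z : Circle) (f : Matrix (Fin 2) (Fin 2) ℂ → E) (ψ : ℝ), F z f ψ = (2 * Real.sin ψ) •
      ∫ h : unitaryGroupOfForm (starRingEnd ℂ) ((Matrix.diagonal a).map w.1.embedding),
        f (((h * ⟨circleDiagonal 2 ![z * Circle.exp ψ, z * Circle.exp (-ψ)], circleDiagonal_mem_archLocal_diagonal L 2 a w _⟩ * h⁻¹ :
          unitaryGroupOfForm (starRingEnd ℂ) ((Matrix.diagonal a).map w.1.embedding)) : GL (Fin 2) ℂ) : Matrix (Fin 2) (Fin 2) ℂ) ∂μ)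
    {f : Matrix (Fin 2) (Fin 2) ℂ → E} (hf : ContDiff ℝ ∞ f) (hfc : HasCompactSupport f) (n : ℕ) :
    ∃ Lp Lm : Circle →ᵇ E,
      (∀ z : Circle, Tendsto (fun ψ => iteratedDeriv n (F z f) ψ) (𝓝[>] 0) (𝓝 (Lp z)) ∧
        Tendsto (fun ψ => iteratedDeriv n (F z f) ψ) (𝓝[<] 0) (𝓝 (Lm z))) ∧
      ∀ ε : ℝ, 0 < ε →
        (∀ᶠ ψ in 𝓝[>] (0 : ℝ), ∀ z : Circle, ‖iteratedDeriv n (F z f) ψ - Lp z‖ ≤ ε) ∧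
        (∀ᶠ ψ in 𝓝[<] (0 : ℝ), ∀ z : Circle, ‖iteratedDeriv n (F z f) ψ - Lm z‖ ≤ ε) := by
  -- the curried family and the `E′ = S¹ →ᵇ E` data at centre `1` (bound variables)
  obtain ⟨g, hg, hgc, hgf⟩ := Literature.Analysis.Calculus.exists_contDiff_curry_circle_smul hf hfc
  obtain ⟨Ω', hΩ'⟩ : ∃ Ω' : (Matrix (Fin 2) (Fin 2) ℂ → (Circle →ᵇ E)) → Matrix (Fin 2) (Fin 2) ℂ → (Circle →ᵇ E),
      ∀ (g : Matrix (Fin 2) (Fin 2) ℂ → (Circle →ᵇ E)) (Y : Matrix (Fin 2) (Fin 2) ℂ), Ω' g Y =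
        -(fderiv ℝ (fderiv ℝ g) Y (Y * !![I, 0; 0, -I]) (Y * !![I, 0; 0, -I]) + fderiv ℝ g Y (Y * !![I, 0; 0, -I] * !![I, 0; 0, -I])) +
          (fderiv ℝ (fderiv ℝ g) Y (Y * !![(0 : ℂ), (p : ℂ); (q : ℂ), 0]) (Y * !![(0 : ℂ), (p : ℂ); (q : ℂ), 0]) +
            fderiv ℝ g Y (Y * !![(0 : ℂ), (p : ℂ); (q : ℂ), 0] * !![(0 : ℂ), (p : ℂ); (q : ℂ), 0])) +
          (fderiv ℝ (fderiv ℝ g) Y (Y * !![(0 : ℂ), -((p : ℂ) * I); (q : ℂ) * I, 0]) (Y * !![(0 : ℂ), -((p : ℂ) * I); (q : ℂ) * I, 0]) +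
            fderiv ℝ g Y (Y * !![(0 : ℂ), -((p : ℂ) * I); (q : ℂ) * I, 0] * !![(0 : ℂ), -((p : ℂ) * I); (q : ℂ) * I, 0])) :=
    ⟨_, fun _ _ => rfl⟩
  obtain ⟨F', hF'⟩ : ∃ F' : (Matrix (Fin 2) (Fin 2) ℂ → (Circle →ᵇ E)) → ℝ → (Circle →ᵇ E),
      ∀ (g : Matrix (Fin 2) (Fin 2) ℂ → (Circle →ᵇ E)) (ψ : ℝ), F' g ψ = (2 * Real.sin ψ) •
        ∫ h : unitaryGroupOfForm (starRingEnd ℂ) ((Matrix.diagonal a).map w.1.embedding),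
          g (((h * ⟨circleDiagonal 2 ![1 * Circle.exp ψ, 1 * Circle.exp (-ψ)], circleDiagonal_mem_archLocal_diagonal L 2 a w _⟩ * h⁻¹ :
            unitaryGroupOfForm (starRingEnd ℂ) ((Matrix.diagonal a).map w.1.embedding)) : GL (Fin 2) ℂ) : Matrix (Fin 2) (Fin 2) ℂ) ∂μ :=
    ⟨_, fun _ _ => rfl⟩
  obtain ⟨Lp, Lm, hlim, hunif⟩ :=
    exists_tendsto_iteratedDeriv_orbitalIntegral_comp_clm_uniform L a w ha hreal hsgn hpq hqe μ Ω' hΩ' 1 (F 1) (hF 1) F' hF' hg hgc n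
  -- `F_z f = F_1 (evalCLM z ∘ g)` and `‖evalCLM z‖ ≤ 1`
  have hfun : ∀ z : Circle, F z f = F 1 (fun X => BoundedContinuousFunction.evalCLM ℝ z (g X)) := fun z => by
    funext ψ'
    rw [orbitalIntegral_centre_eq L a w μ F hF f z ψ']
    simp only [BoundedContinuousFunction.evalCLM_apply, hgf]
  have hnorm : ∀ z : Circle, ‖(BoundedContinuousFunction.evalCLM ℝ z : (Circle →ᵇ E) →L[ℝ] E)‖ ≤ 1 := fun z =>
    ContinuousLinearMap.opNorm_le_bound _ zero_le_one fun G => by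
      simpa only [BoundedContinuousFunction.evalCLM_apply, one_mul] using G.norm_coe_le_norm z
  refine ⟨Lp, Lm, fun z => ?_, fun ε hε => ⟨?_, ?_⟩⟩
  · obtain ⟨h1, h2⟩ := hlim (BoundedContinuousFunction.evalCLM ℝ z)
    rw [hfun z]
    exact ⟨by simpa only [BoundedContinuousFunction.evalCLM_apply] using h1, by simpa only [BoundedContinuousFunction.evalCLM_apply] using h2⟩
  · filter_upwards [(hunif ε hε).1] with ψ hψ z
    have h := hψ (BoundedContinuousFunction.evalCLM ℝ z)
    rw [← hfun z, BoundedContinuousFunction.evalCLM_apply] at h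
    exact h.trans ((mul_le_mul_of_nonneg_right (hnorm z) hε.le).trans (one_mul ε).le)
  · filter_upwards [(hunif ε hε).2] with ψ hψ z
    have h := hψ (BoundedContinuousFunction.evalCLM ℝ z)
    rw [← hfun z, BoundedContinuousFunction.evalCLM_apply] at h
    exact h.trans ((mul_le_mul_of_nonneg_right (hnorm z) hε.le).trans (one_mul ε).le)

/-! ## §4 `E = ℂ`: the jump of every jet is a continuous function of the centre -/

/-- **THE JUMP OF EVERY JET AS A CONTINUOUS FUNCTION ON `S¹`** (`E = ℂ`): for `f ∈ C_c^∞(M₂(ℂ), ℂ)` and every `n` there is `J : S¹ →ᵇ ℂ` with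
`HasOneSidedJump ((F_z f)⁽ⁿ⁾) (J z)` for every centre `z` (`J = Lp − Lm` of §3; its value at each `z` is ★ `exists_hasOneSidedJump_iteratedDeriv_orbitalIntegral`'s: `0` at odd orders,
`(−1)ᵏ C₁ ·` cone integral of `(1+Ω)ᵏ f` at order `2k`, by ★ `HasOneSidedJump.unique`). [cite: Shelstad1979, Lemma 4.3 p. 25] [cite: Varadarajan1989, §6.4 Thms 23–24] -/
theorem exists_hasOneSidedJump_iteratedDeriv_orbitalIntegral_circle_of_contDiff
    (ha : ∀ i, a i ≠ 0) (hreal : ∀ i, (w.1.embedding (a i)).im = 0) (hsgn : (w.1.embedding (a 0)).re * (w.1.embedding (a 1)).re < 0)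
    {p q : ℝ} (hpq : p * q = 1) (hqe : (q : ℂ) ^ 2 * w.1.embedding (a 1) = -w.1.embedding (a 0))
    [MeasurableSpace (unitaryGroupOfForm (starRingEnd ℂ) ((Matrix.diagonal a).map w.1.embedding))]
    [BorelSpace (unitaryGroupOfForm (starRingEnd ℂ) ((Matrix.diagonal a).map w.1.embedding))]
    (μ : Measure (unitaryGroupOfForm (starRingEnd ℂ) ((Matrix.diagonal a).map w.1.embedding))) [μ.IsHaarMeasure] [μ.IsMulRightInvariant]
    (F : Circle → (Matrix (Fin 2) (Fin 2) ℂ → ℂ) → ℝ → ℂ)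
    (hF : ∀ (z : Circle) (f : Matrix (Fin 2) (Fin 2) ℂ → ℂ) (ψ : ℝ), F z f ψ = (2 * Real.sin ψ) •
      ∫ h : unitaryGroupOfForm (starRingEnd ℂ) ((Matrix.diagonal a).map w.1.embedding),
        f (((h * ⟨circleDiagonal 2 ![z * Circle.exp ψ, z * Circle.exp (-ψ)], circleDiagonal_mem_archLocal_diagonal L 2 a w _⟩ * h⁻¹ :
          unitaryGroupOfForm (starRingEnd ℂ) ((Matrix.diagonal a).map w.1.embedding)) : GL (Fin 2) ℂ) : Matrix (Fin 2) (Fin 2) ℂ) ∂μ)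
    {f : Matrix (Fin 2) (Fin 2) ℂ → ℂ} (hf : ContDiff ℝ ∞ f) (hfc : HasCompactSupport f) (n : ℕ) :
    ∃ J : Circle →ᵇ ℂ, ∀ z : Circle, HasOneSidedJump (fun ψ : ℝ => iteratedDeriv n (F z f) ψ) (J z) := by
  obtain ⟨Lp, Lm, hlim, -⟩ := exists_tendsto_iteratedDeriv_orbitalIntegral_uniform_circle_of_contDiff (E := ℂ) L a w ha hreal hsgn hpq hqe μ F hF hf hfc n
  exact ⟨Lp - Lm, fun z => ⟨Lp z, Lm z, (hlim z).1, (hlim z).2, by simp⟩⟩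

end Literature.NumberTheory.Automorphic.RankOneCasimir

end
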